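import Summits.SmoothPoincare4.SmoothPoincare4.Theses.WeylBudget
import Literature.Topology.FourManifolds.GluedMetric
import Literature.Geometry.Manifold.InjOnLocalDiffeomorphInverse
import Literature.Geometry.Manifold.OpenSubmanifoldMFDeriv
import Literature.Geometry.Lorentzian.IsometryProofs
import HarnessLib

/-!
# Isometric regluing, gluing step: the open gluing datum of a local isometry

Support file for the crux `CorkRegluingBudget` (item stmt-SmoothPoincare4-10831, route
WeylBudget, line `registered`, Stub B2 `stub_isometricRegluing`, steps (a) and (d) of its proof).
Everything here is proved; no definitions, no named facts.

Let `S` be a smooth 4-manifold (model `𝓡 4`), `g` a Riemannian metric on `S`, and `Φ : S → S` a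
map which is `C^∞` and injective on an open set `U` with `Φ^* g = g` there.

* `bijective_mfderiv_of_pullbackBilin_eq` — **a Riemannian isometry has invertible
  differential**: `g(v, v) = g(dΦ v, dΦ v)` forces `ker dΦ_x = 0`, and `dΦ_x` is then bijective by
  equality of dimensions (O'Neill 1983, Ch. 3, pp. 58, 90).
* `exists_smoothGlueData` — **the open gluing datum**: for an open `N ⊆ U` and open sets
  `M₁ ⊇ N`, `M₂ ⊇ Φ(N)` of `S`, the partial map `Φ| : N → Φ(N)` is an open partial diffeomorphism
  between the open submanifolds `M₁`, `M₂` (`Φ(N)` is open and `Φ|⁻¹` is `C^∞` by the inverse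
  function theorem, `Literature.Geometry.Manifold.contMDiffOn_invFunOn_of_bijective_mfderiv`),
  i.e. a `Literature.Topology.FourManifolds.SmoothGlueData (𝓡 4) (𝓡 4) M₁ M₂ ℝ⁴` with source
  `N` and value `Φ` (Kosinski 1993, VI.1; Hirsch 1976, Ch. 8 §2).
* `mfderiv_glue_apply` — its differential is `dΦ` (the inclusions of open submanifolds have
  identity differential).

## References

* B. O'Neill, *Semi-Riemannian Geometry* (1983), Ch. 3, p. 58, pp. 90–91. [ONeill1983]
* M. W. Hirsch, *Differential Topology*, GTM 33 (1976), Ch. 8 §2. [HirschDT1976]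
* A. A. Kosinski, *Differential Manifolds* (1993), VI.1. [Kosinski1993]
* J. M. Lee, *Introduction to Smooth Manifolds*, 2nd ed. (2013), Thm. 4.5. [LeeSmoothManifolds2013]
-/

-- the prescribed namespace `Summit.<P>.<Sub>.…` duplicates `SmoothPoincare4` (P = Sub)
set_option linter.dupNamespace false

open scoped Manifold ContDiff Topology
open Set Function

noncomputable section

namespace Summit.SmoothPoincare4.SmoothPoincare4.Theorems.CorkRegluingBudget

open Literature.Geometry.Lorentzian Literature.Geometry.Lorentzian.PseudoRiemannianMetric
  Literature.Geometry.Manifold Literature.Topology.FourManifolds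

variable {S : Type} [TopologicalSpace S] [ChartedSpace (EuclideanSpace ℝ (Fin 4)) S]
  [IsManifold (𝓡 4) ∞ S]

/-! ### (a) A Riemannian isometry has invertible differential -/

/-- **A local isometry of a Riemannian metric has bijective differential**: if
`Φ^* g = g` at `x` and `g` is positive definite, then `dΦ_x v = 0` gives
`g(v, v) = g(dΦ_x v, dΦ_x v) = 0`, so `v = 0`; an injective differential between manifolds of the
same dimension is bijective (`mfderiv_bijective_of_injective`). O'Neill 1983, Ch. 3, p. 58 and
p. 90. [cite: ONeill1983, Ch. 3, p. 58 and p. 90] -/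
theorem bijective_mfderiv_of_pullbackBilin_eq
    (g : PseudoRiemannianMetric (𝓡 4) ∞ (EuclideanSpace ℝ (Fin 4)) (TangentSpace (𝓡 4) : S → Type _))
    (hg : g.IsRiemannian) {Φ : S → S} {x : S}
    (hΦg : pullbackBilin (I := 𝓡 4) (I' := 𝓡 4) Φ g.val x = g.val x) :
    Bijective (mfderiv (𝓡 4) (𝓡 4) Φ x) := by
  refine mfderiv_bijective_of_injective (I := 𝓡 4) (I' := 𝓡 4) ?_ rfl
  have key : ∀ u : TangentSpace (𝓡 4) x, mfderiv (𝓡 4) (𝓡 4) Φ x u = 0 → u = 0 := by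
    intro u hu
    by_contra hne
    have hpos := hg x u hne
    have h0 := DFunLike.congr_fun (DFunLike.congr_fun hΦg u) u
    rw [pullbackBilin_apply, hu, map_zero] at h0
    rw [← h0] at hpos
    exact lt_irrefl _ hpos
  intro v w hvw
  exact sub_eq_zero.1 (key (v - w) (by rw [map_sub, hvw, sub_self]))

/-! ### (d) The open gluing datum `Φ| : N → Φ(N)` between open submanifolds -/

/-- **The open gluing datum of a local diffeomorphism.** Let `Φ` be `C^∞` and injective on the
open set `U ⊆ S` with bijective differential there, `N ⊆ U` open, and `M₁ ⊇ N`, `M₂ ⊇ Φ(N)` open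
subsets of `S` (nonempty). Then there is a gluing datum
`d : SmoothGlueData (𝓡 4) (𝓡 4) M₁ M₂ ℝ⁴` between the open submanifolds `M₁`, `M₂` whose gluing
map has source `N` (pulled back to `M₁`) and is `Φ` there: `Φ(N)` is open
(`isOpen_image_of_bijective_mfderiv`) and the inverse `Φ|⁻¹ : Φ(N) → N` is `C^∞`
(`contMDiffOn_invFunOn_of_bijective_mfderiv`, inverse function theorem, Lee 2013 Thm. 4.5);
smoothness into / out of the open submanifolds is read through the inclusions
(`ContMDiffAt.subtypeVal_comp_iff`, `contMDiffAt_subtype_iff`). Kosinski 1993, VI.1; Hirsch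
1976, Ch. 8 §2 (the datum of `M₁ ∪_Φ M₂`). [cite: HirschDT1976, Ch. 8 §2]
[cite: LeeSmoothManifolds2013, Thm. 4.5] -/
theorem exists_smoothGlueData {U N : Set S} {Φ : S → S} (hU : IsOpen U) (hN : IsOpen N)
    (hNU : N ⊆ U) (hΦs : ContMDiffOn (𝓡 4) (𝓡 4) ∞ Φ U) (hΦi : InjOn Φ U)
    (hbij : ∀ x ∈ U, Bijective (mfderiv (𝓡 4) (𝓡 4) Φ x))
    (M₁ M₂ : TopologicalSpace.Opens S) (h₁ : N ⊆ M₁) (h₂ : Φ '' N ⊆ M₂)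
    [Nonempty M₁] [Nonempty M₂] :
    ∃ d : SmoothGlueData (𝓡 4) (𝓡 4) M₁ M₂ (EuclideanSpace ℝ (Fin 4)),
      (∀ a : M₁, a ∈ d.glue.source ↔ (a : S) ∈ N) ∧
      (∀ a : M₁, (a : S) ∈ N → ((d.glue a : M₂) : S) = Φ a) := by
  classical
  haveI : Nonempty S := ⟨((Classical.arbitrary M₁ : M₁) : S)⟩
  have hΦsN : ContMDiffOn (𝓡 4) (𝓡 4) ∞ Φ N := hΦs.mono hNU
  have hΦiN : InjOn Φ N := hΦi.mono hNU
  have hbijN : ∀ x ∈ N, Bijective (mfderiv (𝓡 4) (𝓡 4) Φ x) := fun x hx ↦ hbij x (hNU hx)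
  have hopen : IsOpen (Φ '' N) := isOpen_image_of_bijective_mfderiv hN hΦsN hbijN
  have hinv : ContMDiffOn (𝓡 4) (𝓡 4) ∞ (invFunOn Φ N) (Φ '' N) :=
    contMDiffOn_invFunOn_of_bijective_mfderiv hN hΦsN hΦiN hbijN
  -- the total maps `M₁ → M₂`, `M₂ → M₁`
  set f : M₁ → M₂ := fun a ↦
    if h : Φ (a : S) ∈ M₂ then ⟨Φ a, h⟩ else Classical.arbitrary M₂ with hfdef
  set f' : M₂ → M₁ := fun b ↦
    if h : invFunOn Φ N (b : S) ∈ M₁ then ⟨invFunOn Φ N b, h⟩ else Classical.arbitrary M₁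
    with hf'def
  have hf : ∀ a : M₁, (a : S) ∈ N → ((f a : M₂) : S) = Φ a := fun a ha ↦ by
    have hc : Φ (a : S) ∈ M₂ := h₂ (mem_image_of_mem Φ ha)
    simp only [hfdef, dif_pos hc]
  have hf' : ∀ b : M₂, (b : S) ∈ Φ '' N → ((f' b : M₁) : S) = invFunOn Φ N b := fun b hb ↦ by
    have hc : invFunOn Φ N (b : S) ∈ M₁ := h₁ (Function.invFunOn_mem hb)
    simp only [hf'def, dif_pos hc]
  -- smoothness of `f` on `N` and of `f'` on `Φ(N)`
  have hfs : ContMDiffOn (𝓡 4) (𝓡 4) ∞ f (Subtype.val ⁻¹' N) := by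
    intro a ha
    refine ContMDiffAt.contMDiffWithinAt ?_
    rw [← ContMDiffAt.subtypeVal_comp_iff]
    have hev : (Subtype.val ∘ f) =ᶠ[𝓝 a] fun a' : M₁ ↦ Φ a' := by
      filter_upwards [(hN.preimage continuous_subtype_val).mem_nhds ha] with a' ha'
      exact hf a' ha'
    refine ContMDiffAt.congr_of_eventuallyEq ?_ hev
    exact contMDiffAt_subtype_iff.2 (hΦs.contMDiffAt (hU.mem_nhds (hNU ha)))
  have hf's : ContMDiffOn (𝓡 4) (𝓡 4) ∞ f' (Subtype.val ⁻¹' (Φ '' N)) := by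
    intro b hb
    refine ContMDiffAt.contMDiffWithinAt ?_
    rw [← ContMDiffAt.subtypeVal_comp_iff]
    have hev : (Subtype.val ∘ f') =ᶠ[𝓝 b] fun b' : M₂ ↦ invFunOn Φ N b' := by
      filter_upwards [(hopen.preimage continuous_subtype_val).mem_nhds hb] with b' hb'
      exact hf' b' hb'
    refine ContMDiffAt.congr_of_eventuallyEq ?_ hev
    exact contMDiffAt_subtype_iff.2 (hinv.contMDiffAt (hopen.mem_nhds hb))
  -- the open partial homeomorphism
  let e : OpenPartialHomeomorph M₁ M₂ :=
  { toFun := f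
    invFun := f'
    source := Subtype.val ⁻¹' N
    target := Subtype.val ⁻¹' (Φ '' N)
    map_source' := fun a ha ↦ by
      show ((f a : M₂) : S) ∈ Φ '' N
      rw [hf a ha]
      exact mem_image_of_mem Φ ha
    map_target' := fun b hb ↦ by
      show ((f' b : M₁) : S) ∈ N
      rw [hf' b hb]
      exact Function.invFunOn_mem hb
    left_inv' := fun a ha ↦ by
      apply Subtype.ext
      have h1 : ((f a : M₂) : S) ∈ Φ '' N := by
        rw [hf a ha]
        exact mem_image_of_mem Φ ha
      rw [hf' _ h1, hf a ha]
      exact invFunOn_apply hΦiN ha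
    right_inv' := fun b hb ↦ by
      apply Subtype.ext
      have h1 : ((f' b : M₁) : S) ∈ N := by
        rw [hf' b hb]
        exact Function.invFunOn_mem hb
      rw [hf _ h1, hf' b hb]
      exact apply_invFunOn hb
    open_source := hN.preimage continuous_subtype_val
    open_target := hopen.preimage continuous_subtype_val
    continuousOn_toFun := hfs.continuousOn
    continuousOn_invFun := hf's.continuousOn }
  refine ⟨⟨e, hfs, hf's, ContinuousLinearEquiv.refl ℝ _, ContinuousLinearEquiv.refl ℝ _⟩,
    fun a ↦ Iff.rfl, fun a ha ↦ hf a ha⟩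

/-! ### The differential of the gluing map -/

omit [IsManifold (𝓡 4) ∞ S] in
/-- **The gluing map has differential `dΦ`.** If the gluing map of
`d : SmoothGlueData (𝓡 4) (𝓡 4) M₁ M₂ ℝ⁴` (open submanifolds `M₁`, `M₂` of `S`) has source `N`
and value `Φ` there, with `Φ` smooth on an open `U ⊇ N`, then for `a ∈ N` its differential is
`dΦ_a` (both composites `ι ∘ ψ = Φ ∘ ι` near `a`, and the inclusions `ι` have identity
differential, `OpenSubmanifold.hasMFDerivAt_subtype_val`). [folklore] -/
theorem mfderiv_glue_apply {M₁ M₂ : TopologicalSpace.Opens S}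
    (d : SmoothGlueData (𝓡 4) (𝓡 4) M₁ M₂ (EuclideanSpace ℝ (Fin 4))) {U N : Set S} {Φ : S → S}
    (hsrc : ∀ a : M₁, a ∈ d.glue.source ↔ (a : S) ∈ N)
    (hval : ∀ a : M₁, (a : S) ∈ N → ((d.glue a : M₂) : S) = Φ a)
    (hU : IsOpen U) (hNU : N ⊆ U) (hΦs : ContMDiffOn (𝓡 4) (𝓡 4) ∞ Φ U) {a : M₁}
    (ha : (a : S) ∈ N) (v : TangentSpace (𝓡 4) a) :
    mfderiv (𝓡 4) (𝓡 4) d.glue a v = mfderiv (𝓡 4) (𝓡 4) Φ (a : S) v := by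
  have hsrc' : a ∈ d.glue.source := (hsrc a).2 ha
  have hglue : MDifferentiableAt (𝓡 4) (𝓡 4) d.glue a :=
    (d.contMDiffOn_glue.contMDiffAt (d.glue.open_source.mem_nhds hsrc')).mdifferentiableAt
      (by simp)
  have hΦ : MDifferentiableAt (𝓡 4) (𝓡 4) Φ (a : S) :=
    (hΦs.contMDiffAt (hU.mem_nhds (hNU ha))).mdifferentiableAt (by simp)
  have h1 : HasMFDerivAt (𝓡 4) (𝓡 4) (Subtype.val ∘ d.glue) a
      ((ContinuousLinearMap.id ℝ (EuclideanSpace ℝ (Fin 4))).comp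
        (mfderiv (𝓡 4) (𝓡 4) d.glue a)) :=
    (OpenSubmanifold.hasMFDerivAt_subtype_val (d.glue a)).comp a hglue.hasMFDerivAt
  have h2 : HasMFDerivAt (𝓡 4) (𝓡 4) (Φ ∘ (Subtype.val : M₁ → S)) a
      ((mfderiv (𝓡 4) (𝓡 4) Φ (a : S)).comp
        (ContinuousLinearMap.id ℝ (EuclideanSpace ℝ (Fin 4)))) :=
    hΦ.hasMFDerivAt.comp a (OpenSubmanifold.hasMFDerivAt_subtype_val a)
  have hev : (Subtype.val ∘ d.glue) =ᶠ[𝓝 a] (Φ ∘ (Subtype.val : M₁ → S)) := by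
    filter_upwards [d.glue.open_source.mem_nhds hsrc'] with a' ha'
    exact hval a' ((hsrc a').1 ha')
  have h3 := (h2.congr_of_eventuallyEq hev).mfderiv
  rw [h1.mfderiv] at h3
  exact DFunLike.congr_fun h3 v

/-- **Registered helper `helper_exists_smoothGlueData`** (sub-goal of Stub B2
`stub_isometricRegluing` of the crux `CorkRegluingBudget`, step (d)): the statement of
`exists_smoothGlueData` in registered binder form — the open gluing datum `Φ| : N → Φ(N)`
between open submanifolds `M₁ ⊇ N`, `M₂ ⊇ Φ(N)` of a smooth 4-manifold, for `Φ` smooth and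
injective with bijective differential on an open `U ⊇ N`. [cite: HirschDT1976, Ch. 8 §2]
[cite: LeeSmoothManifolds2013, Thm. 4.5] -/
theorem helper_exists_smoothGlueData :
    ∀ (S : Type) [TopologicalSpace S] [ChartedSpace (EuclideanSpace ℝ (Fin 4)) S]
      [IsManifold (𝓡 4) ∞ S] (U N : Set S) (Φ : S → S),
      IsOpen U → IsOpen N → N ⊆ U → ContMDiffOn (𝓡 4) (𝓡 4) ∞ Φ U → Set.InjOn Φ U →
      (∀ x ∈ U, Function.Bijective (mfderiv (𝓡 4) (𝓡 4) Φ x)) →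
      ∀ (M₁ M₂ : TopologicalSpace.Opens S), N ⊆ (M₁ : Set S) → Φ '' N ⊆ (M₂ : Set S) →
      Nonempty M₁ → Nonempty M₂ →
      ∃ d : Literature.Topology.FourManifolds.SmoothGlueData (𝓡 4) (𝓡 4) M₁ M₂
        (EuclideanSpace ℝ (Fin 4)),
        (∀ a : M₁, a ∈ d.glue.source ↔ (a : S) ∈ N) ∧
        (∀ a : M₁, (a : S) ∈ N → ((d.glue a : M₂) : S) = Φ a) := by
  intro S _ _ _ U N Φ hU hN hNU hΦs hΦi hbij M₁ M₂ h₁ h₂ hne₁ hne₂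
  exact exists_smoothGlueData hU hN hNU hΦs hΦi hbij M₁ M₂ h₁ h₂

end Summit.SmoothPoincare4.SmoothPoincare4.Theorems.CorkRegluingBudget

end
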